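import Literature.NumberTheory.EllipticCurves.KleinFrickeLevelSeven
import HarnessLib

/-!
# Klein–Fricke at level `7`, the excluded fibre `j = 0`: no rational `7`-isogeny

Complement to `KleinFrickeLevelSeven.lean`, whose theorem
`Isogeny.exists_j_eq_klein_seven_of_degree_eq_seven` (a `K`-rational `7`-isogeny forces
`j = (t² + 13t + 49)(t² + 5t + 1)³/t`, `t ∈ Kˣ`) carries the hypothesis `j ≠ 0`: at `j = 0` both
formulae for the Hauptmodul `t` of `X₀(7)` in terms of the kernel coordinates may degenerate. This
file closes the gap over the fields that matter (e.g. `ℚ`): **an elliptic curve with `j = 0` over a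
field of characteristic `0` containing neither a primitive cube root of unity nor `√21` admits no
rational isogeny of degree `7`** (`Isogeny.j_ne_zero_of_degree_eq_seven`). Classically: the fibre of
`X₀(7) → X(1)` over `j = 0` consists of the two points `t² + 13t + 49 = 0` (the `CM` subgroups
`E[π], E[π̄]`, `7 = ππ̄` in `ℤ[ω]`, defined over `ℚ(√-3)`) and the two ramified points
`t² + 5t + 1 = 0` (defined over `ℚ(√21)`), none rational.

## Proof (elementary, inside the algebra of `KleinFrickeLevelSeven`)

* `Isogeny.exists_kernel_coords_of_degree_eq_seven₃`: the tree's kernel-coordinate theorem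
  (`x₁ = x(P)`, `x₂ = x(2P)`, `x₃ = x(3P)` for a generator `P` of the kernel; the duplication and
  chord relations; descent of the symmetric functions by Galois theory), re-proved verbatim with
  the THIRD symmetric function `x₁x₂x₃` also descended (the full kernel polynomial is `K`-rational).
* `klein_seven_core` (tree) at `a = 0`: both cleared Fricke identities read
  `0 = 27b²·(U² + 13UV + 49V²)(U² + 5UV + V²)³`; since `U² + 13UV + 49V² = 0` needs `√-3 ∈ K` and
  `U² + 5UV + V² = 0` needs `√21 ∈ K`, all four of `U₁, V₁, U₂, V₂` vanish, whence
  `s₁ = x₁ + x₂ + x₃ = 0` and `s₂ = x₁x₂ + x₁x₃ + x₂x₃ = 0`; so `x₂ = ζx₁`, `x₃ = ζ²x₁` with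
  `ζ² + ζ + 1 = 0` in `K̄`, `x₁ ≠ 0`, and `s₃ = x₁x₂x₃ = x₁³ ∈ K`; the duplication relation
  `4(x₁³ + b)x₂ = x₁⁴ − 8bx₁` then gives `ζ = (s₃ − 8b)/(4(s₃ + b)) ∈ K` — a primitive cube root of
  unity in `K`, excluded.
-/

noncomputable section

open scoped Classical

universe u

namespace WeierstrassCurve

namespace Isogeny

open Literature.NumberTheory.EllipticCurves Polynomial

variable {K : Type u} [Field K] [CharZero K] {V V' : WeierstrassCurve K}

set_option maxHeartbeats 1600000 in
/-- **Kernel coordinates of a degree-`7` isogeny on a short Weierstrass curve, with all three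
symmetric functions** (the tree's `exists_kernel_coords_of_degree_eq_seven`, whose proof is
repeated verbatim, additionally descends the product `x₁x₂x₃`, i.e. the whole kernel polynomial
`(X - x₁)(X - x₂)(X - x₃) ∈ K[X]`). If `φ : V → V'`
has degree `7` (`V : y² = x³ + ax + b`, characteristic `0`) and `P` generates `ker φ`, then with
`x₁ = x(P)`, `x₂ = x(2P)`, `x₃ = x(3P)`: the symmetric functions `x₁ + x₂ + x₃`,
`x₁x₂ + x₁x₃ + x₂x₃` and `x₁x₂x₃` are in `K` (`Γ_K` permutes `ker φ ∖ {O}` and induces a cyclic permutation of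
`(x₁, x₂, x₃)`), `x₁ ≠ x₂`, `f(x₁) ≠ 0`, `f(x₂) ≠ 0`, and the three relations
`4f(x₁)x₂ = N(x₁)` (`2·P`), `4f(x₂)x₃ = N(x₂)` (`2·2P = 4P = -3P`), and
`x₃(x₁-x₂)² = 2(x₁x₂+a)(x₁+x₂) + 4b - x₁(x₁-x₂)²` (`x(P+2P) + x(P-2P)`, `P - 2P = -P`).
[cite: SilvermanAEC2009, III.2.3, III.4.12] -/
theorem exists_kernel_coords_of_degree_eq_seven₃ [V.IsShortNF] (φ : Isogeny V V')
    (hdeg : φ.degree = 7) :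
    ∃ (x₁ x₂ x₃ : AlgebraicClosure K) (s₀ p₀ r₀ : K),
      algebraMap K (AlgebraicClosure K) s₀ = x₁ + x₂ + x₃ ∧
      algebraMap K (AlgebraicClosure K) p₀ = x₁ * x₂ + x₁ * x₃ + x₂ * x₃ ∧
      algebraMap K (AlgebraicClosure K) r₀ = x₁ * x₂ * x₃ ∧ x₁ ≠ x₂ ∧
      x₁ ^ 3 + algebraMap K _ V.a₄ * x₁ + algebraMap K _ V.a₆ ≠ 0 ∧
      x₂ ^ 3 + algebraMap K _ V.a₄ * x₂ + algebraMap K _ V.a₆ ≠ 0 ∧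
      4 * (x₁ ^ 3 + algebraMap K _ V.a₄ * x₁ + algebraMap K _ V.a₆) * x₂ =
        x₁ ^ 4 - 2 * algebraMap K _ V.a₄ * x₁ ^ 2 - 8 * algebraMap K _ V.a₆ * x₁ +
          algebraMap K _ V.a₄ ^ 2 ∧
      4 * (x₂ ^ 3 + algebraMap K _ V.a₄ * x₂ + algebraMap K _ V.a₆) * x₃ =
        x₂ ^ 4 - 2 * algebraMap K _ V.a₄ * x₂ ^ 2 - 8 * algebraMap K _ V.a₆ * x₂ +
          algebraMap K _ V.a₄ ^ 2 ∧
      x₃ * (x₁ - x₂) ^ 2 =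
        2 * (x₁ * x₂ + algebraMap K _ V.a₄) * (x₁ + x₂) + 4 * algebraMap K _ V.a₆ -
          x₁ * (x₁ - x₂) ^ 2 := by
  haveI : IsGalois K (AlgebraicClosure K) := {}
  set Vb := V.baseChange (AlgebraicClosure K) with hVb
  have hba₁ : Vb.a₁ = 0 := by simp [hVb]
  have hba₂ : Vb.a₂ = 0 := by simp [hVb]
  have hba₃ : Vb.a₃ = 0 := by simp [hVb]
  haveI : Vb.IsShortNF := ⟨hba₁, hba₂, hba₃⟩
  have hba₄ : Vb.a₄ = algebraMap K _ V.a₄ := rfl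
  have hba₆ : Vb.a₆ = algebraMap K _ V.a₆ := rfl
  -- a nonzero kernel point `P`, of order `7`
  set A := φ.toAddMonoidHom.ker with hA
  haveI : Finite A := φ.finite_ker'
  have hnt : 1 < Nat.card A := by rw [show Nat.card A = 7 from hdeg]; norm_num
  obtain ⟨P, hP0⟩ : ∃ P : A, P ≠ 0 :=
    haveI := Finite.one_lt_card_iff_nontrivial.mp hnt
    exists_ne 0
  have hord : addOrderOf P = 7 := by
    have hdvd : addOrderOf P ∣ 7 := hdeg ▸ addOrderOf_dvd_natCard P
    rcases (Nat.dvd_prime (by norm_num : Nat.Prime 7)).mp hdvd with h1 | h7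
    · exact absurd (AddMonoid.addOrderOf_eq_one_iff.mp h1) hP0
    · exact h7
  have hmul : ∀ k : ℕ, k • (P : V.geomPoints) = 0 → 7 ∣ k := by
    intro k hk
    have hk' : k • P = 0 := Subtype.ext (by rw [AddSubmonoidClass.coe_nsmul]; exact hk)
    exact hord ▸ addOrderOf_dvd_of_nsmul_eq_zero hk'
  have h7P : (7 : ℕ) • (P : V.geomPoints) = 0 := by
    have := addOrderOf_nsmul_eq_zero P
    rw [hord] at this
    exact_mod_cast congrArg Subtype.val this
  have hPne : (P : V.geomPoints) ≠ 0 := fun h ↦ hP0 (Subtype.ext h)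
  have hkP : ∀ k : ℕ, 0 < k → k < 7 → k • (P : V.geomPoints) ≠ 0 := fun k hk hk7 h ↦ by
    have := Nat.le_of_dvd hk (hmul k h); omega
  -- coordinates of `P`
  obtain ⟨P₀, hP₀A⟩ := P
  simp only at hPne hkP h7P hmul
  change Vb.toAffine.Point at P₀
  rcases P₀ with _ | ⟨x₁, y₁, h₁⟩
  · exact (hPne rfl).elim
  set P₀ : V.geomPoints := (Affine.Point.some x₁ y₁ h₁ : Vb.toAffine.Point) with hP₀def
  -- reduction of multiples mod 7
  have hmod : ∀ m : ℕ, m • P₀ = (m % 7) • P₀ := fun m ↦ by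
    conv_lhs => rw [← Nat.mod_add_div m 7, add_nsmul, mul_nsmul, h7P, nsmul_zero, add_zero]
  have h2P := hkP 2 (by norm_num) (by norm_num)
  have h3P := hkP 3 (by norm_num) (by norm_num)
  have h4P := hkP 4 (by norm_num) (by norm_num)
  have h6P := hkP 6 (by norm_num) (by norm_num)
  -- negatives: `(7 - k) • P = -(k • P)`
  have hneg : ∀ k : ℕ, k ≤ 7 → (7 - k) • P₀ = -(k • P₀) := fun k hk ↦ by
    rw [eq_neg_iff_add_eq_zero, ← add_nsmul, Nat.sub_add_cancel hk, h7P]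
  -- `P` is not `2`-torsion
  have hy₁ : y₁ ≠ Vb.toAffine.negY x₁ y₁ := by
    intro hy
    apply h2P
    rw [two_nsmul]
    change (Affine.Point.some x₁ y₁ h₁ : Vb.toAffine.Point) + Affine.Point.some x₁ y₁ h₁ = 0
    have hn : -(Affine.Point.some x₁ y₁ h₁ : Vb.toAffine.Point) = Affine.Point.some x₁ y₁ h₁ := by
      rw [Affine.Point.neg_some]; simp only [Affine.Point.some.injEq, true_and]; exact hy.symm
    nth_rewrite 2 [← hn]
    exact add_neg_cancel _
  -- `Q₂ = 2P`
  set x₂ := Vb.toAffine.addX x₁ x₁ (Vb.toAffine.slope x₁ x₁ y₁ y₁) with hx₂def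
  set y₂ := Vb.toAffine.addY x₁ x₁ y₁ (Vb.toAffine.slope x₁ x₁ y₁ y₁) with hy₂def
  have h₂ : Vb.toAffine.Nonsingular x₂ y₂ := Affine.nonsingular_add h₁ h₁ fun hxy => hy₁ hxy.right
  have hQ₂ : (2 : ℕ) • P₀ = (Affine.Point.some x₂ y₂ h₂ : Vb.toAffine.Point) := by
    rw [two_nsmul]; exact Affine.Point.add_self_of_Y_ne hy₁
  have hR1 := Vb.addX_self_mul_of_isShortNF h₁ hy₁
  rw [← hx₂def] at hR1
  -- `x₁ ≠ x₂`
  have heq₁ := (Affine.equation_iff ..).mp h₁.1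
  have heq₂ := (Affine.equation_iff ..).mp h₂.1
  have hy₁' := hy₁
  simp only [Affine.negY, hba₁, hba₂, hba₃, zero_mul, sub_zero, add_zero] at hy₁' heq₁ heq₂
  have hf₁ : x₁ ^ 3 + Vb.a₄ * x₁ + Vb.a₆ ≠ 0 := by
    rw [← heq₁]; exact pow_ne_zero 2 fun h ↦ hy₁' (by rw [h, neg_zero])
  have hx₁₂ : x₁ ≠ x₂ := by
    intro hx
    have hyy : (y₂ - y₁) * (y₂ + y₁) = 0 := by
      have : y₂ ^ 2 = y₁ ^ 2 := by rw [heq₁, heq₂, hx]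
      linear_combination this
    rcases mul_eq_zero.mp hyy with hy | hy
    · apply hPne
      have e : (2 : ℕ) • P₀ = P₀ := by
        rw [hQ₂]
        change (Affine.Point.some x₂ y₂ h₂ : Vb.toAffine.Point) = Affine.Point.some x₁ y₁ h₁
        simp only [Affine.Point.some.injEq]
        exact ⟨hx.symm, sub_eq_zero.mp hy⟩
      have := congrArg (· - P₀) e
      simpa [two_nsmul] using this
    · apply h3P
      have e : (2 : ℕ) • P₀ = -P₀ := by
        rw [hQ₂]
        change (Affine.Point.some x₂ y₂ h₂ : Vb.toAffine.Point) = -Affine.Point.some x₁ y₁ h₁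
        rw [Affine.Point.neg_some]
        simp only [Affine.Point.some.injEq, Affine.negY, hba₁, hba₃, zero_mul, sub_zero]
        exact ⟨hx.symm, eq_neg_of_add_eq_zero_left hy⟩
      rw [show (3 : ℕ) = 2 + 1 from rfl, add_nsmul, one_nsmul, e, neg_add_cancel]
  -- `Q₃ = 3P = P + 2P`
  set x₃ := Vb.toAffine.addX x₁ x₂ (Vb.toAffine.slope x₁ x₂ y₁ y₂) with hx₃def
  set y₃ := Vb.toAffine.addY x₁ x₂ y₁ (Vb.toAffine.slope x₁ x₂ y₁ y₂) with hy₃def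
  have h₃ : Vb.toAffine.Nonsingular x₃ y₃ := Affine.nonsingular_add h₁ h₂ fun hxy => hx₁₂ hxy.1
  have hQ₃ : (3 : ℕ) • P₀ = (Affine.Point.some x₃ y₃ h₃ : Vb.toAffine.Point) := by
    rw [show (3 : ℕ) = 1 + 2 from rfl, add_nsmul, one_nsmul, hQ₂]
    exact Affine.Point.add_of_X_ne hx₁₂
  -- `4P = -3P`, `5P = -2P`, `6P = -P`
  have h4 : (4 : ℕ) • P₀ = -(Affine.Point.some x₃ y₃ h₃ : Vb.toAffine.Point) := by
    rw [← hQ₃]; exact hneg 3 (by norm_num)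
  have h5 : (5 : ℕ) • P₀ = -(Affine.Point.some x₂ y₂ h₂ : Vb.toAffine.Point) := by
    rw [← hQ₂]; exact hneg 2 (by norm_num)
  have h6 : (6 : ℕ) • P₀ = -(Affine.Point.some x₁ y₁ h₁ : Vb.toAffine.Point) := hneg 1 (by norm_num)
  -- `R2`: doubling `2P ↦ 4P = -3P`
  have hy₂ : y₂ ≠ Vb.toAffine.negY x₂ y₂ := by
    intro hy
    apply h4P
    have e : (4 : ℕ) • P₀ = (2 : ℕ) • P₀ + (2 : ℕ) • P₀ := by rw [← add_nsmul]
    rw [e, hQ₂]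
    have hn : -(Affine.Point.some x₂ y₂ h₂ : Vb.toAffine.Point) = Affine.Point.some x₂ y₂ h₂ := by
      rw [Affine.Point.neg_some]; simp only [Affine.Point.some.injEq, true_and]; exact hy.symm
    nth_rewrite 2 [← hn]
    exact add_neg_cancel _
  have hR2 : x₃ * (4 * (x₂ ^ 3 + Vb.a₄ * x₂ + Vb.a₆)) =
      x₂ ^ 4 - 2 * Vb.a₄ * x₂ ^ 2 - 8 * Vb.a₆ * x₂ + Vb.a₄ ^ 2 := by
    have hdup := Vb.addX_self_mul_of_isShortNF h₂ hy₂
    have e : ((Affine.Point.some x₂ y₂ h₂ : Vb.toAffine.Point) +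
        (Affine.Point.some x₂ y₂ h₂ : Vb.toAffine.Point) : Vb.toAffine.Point) =
        -Affine.Point.some x₃ y₃ h₃ := by
      have e1 : (4 : ℕ) • P₀ = (2 : ℕ) • P₀ + (2 : ℕ) • P₀ := by rw [← add_nsmul]
      rw [hQ₂] at e1
      exact e1.symm.trans h4
    have hx : Vb.toAffine.addX x₂ x₂ (Vb.toAffine.slope x₂ x₂ y₂ y₂) = x₃ := by
      rw [Affine.Point.add_self_of_Y_ne hy₂, Affine.Point.neg_some] at e
      simp only [Affine.Point.some.injEq] at e
      exact e.1
    rwa [hx] at hdup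
  have hy₂' := hy₂
  simp only [Affine.negY, hba₁, hba₃, zero_mul, sub_zero] at hy₂'
  have hf₂ : x₂ ^ 3 + Vb.a₄ * x₂ + Vb.a₆ ≠ 0 := by
    rw [← heq₂]; exact pow_ne_zero 2 fun h ↦ hy₂' (by rw [h, neg_zero])
  -- `R3`: `x(P + 2P) + x(P - 2P) = x₃ + x₁`
  have hR3 : x₃ * (x₁ - x₂) ^ 2 =
      2 * (x₁ * x₂ + Vb.a₄) * (x₁ + x₂) + 4 * Vb.a₆ - x₁ * (x₁ - x₂) ^ 2 := by
    have hsum := Vb.addX_add_addX_neg_mul_of_isShortNF h₁ h₂ hx₁₂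
    -- `P + (-2P) = -P`, so the second `addX` is `x₁`
    have e : ((Affine.Point.some x₁ y₁ h₁ : Vb.toAffine.Point) +
        (-(Affine.Point.some x₂ y₂ h₂ : Vb.toAffine.Point)) : Vb.toAffine.Point) =
        -Affine.Point.some x₁ y₁ h₁ := by
      have e1 : P₀ + (5 : ℕ) • P₀ = (6 : ℕ) • P₀ := by
        rw [show (6 : ℕ) = 1 + 5 from rfl, add_nsmul, one_nsmul]
      rw [h5, h6] at e1
      exact e1
    have hx : Vb.toAffine.addX x₁ x₂ (Vb.toAffine.slope x₁ x₂ y₁ (Vb.toAffine.negY x₂ y₂)) = x₁ := by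
      rw [Affine.Point.neg_some, Affine.Point.add_of_X_ne hx₁₂, Affine.Point.neg_some] at e
      simp only [Affine.Point.some.injEq] at e
      exact e.1
    rw [hx, ← hx₃def] at hsum
    linear_combination hsum
  -- Galois: `σ` permutes `(x₁, x₂, x₃)` cyclically
  have hset : ∀ R ∈ (A : Set V.geomPoints), ∃ k : ℕ, k < 7 ∧ R = k • P₀ := by
    have hsub : (Finset.image (fun k : Fin 7 ↦ (k : ℕ) • P₀) Finset.univ : Set V.geomPoints) ⊆
        (A : Set V.geomPoints) := by
      intro R hR
      simp only [Finset.coe_image, Finset.coe_univ, Set.image_univ, Set.mem_range] at hR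
      obtain ⟨k, rfl⟩ := hR
      exact A.nsmul_mem hP₀A _
    have hinj : Function.Injective fun k : Fin 7 ↦ (k : ℕ) • P₀ := by
      intro i j hij
      simp only at hij
      ext
      by_contra hne
      rcases Nat.lt_or_gt_of_ne hne with hlt | hlt
      · have h0 : ((j : ℕ) - i) • P₀ = 0 := by
          have : ((j : ℕ) - i) • P₀ + (i : ℕ) • P₀ = (j : ℕ) • P₀ := by
            rw [← add_nsmul, Nat.sub_add_cancel hlt.le]
          rw [hij] at this
          simpa using this
        exact hkP _ (by omega) (by omega) h0
      · have h0 : ((i : ℕ) - j) • P₀ = 0 := by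
          have : ((i : ℕ) - j) • P₀ + (j : ℕ) • P₀ = (i : ℕ) • P₀ := by
            rw [← add_nsmul, Nat.sub_add_cancel hlt.le]
          rw [← hij] at this
          simpa using this
        exact hkP _ (by omega) (by omega) h0
    have hcard : (Finset.image (fun k : Fin 7 ↦ (k : ℕ) • P₀) Finset.univ).card = 7 := by
      rw [Finset.card_image_of_injective _ hinj]; simp
    have heqset : (Finset.image (fun k : Fin 7 ↦ (k : ℕ) • P₀) Finset.univ : Set V.geomPoints) =
        (A : Set V.geomPoints) := by
      apply Set.eq_of_subset_of_ncard_le hsub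
      · rw [← Nat.card_coe_set_eq (A : Set V.geomPoints), SetLike.coe_sort_coe,
          show Nat.card A = 7 from hdeg, Set.ncard_coe_finset, hcard]
    intro R hR
    rw [← heqset] at hR
    simp only [Finset.coe_image, Finset.coe_univ, Set.image_univ, Set.mem_range] at hR
    obtain ⟨k, rfl⟩ := hR
    exact ⟨k, k.isLt, rfl⟩
  have hfix : ∀ σ : AlgebraicClosure K ≃ₐ[K] AlgebraicClosure K,
      σ (x₁ + x₂ + x₃) = x₁ + x₂ + x₃ ∧
        σ (x₁ * x₂ + x₁ * x₃ + x₂ * x₃) = x₁ * x₂ + x₁ * x₃ + x₂ * x₃ ∧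
        σ (x₁ * x₂ * x₃) = x₁ * x₂ * x₃ := by
    intro σ
    set τ : Field.absoluteGaloisGroup K := σ with hτ
    have hτP : τ • P₀ ∈ (A : Set V.geomPoints) := by
      change τ • P₀ ∈ φ.toAddMonoidHom.ker
      rw [AddMonoidHom.mem_ker, coe_toAddMonoidHom, φ.map_smul,
        show φ P₀ = 0 from (AddMonoidHom.mem_ker).mp hP₀A, smul_zero]
    have hτn : ∀ n : ℕ, τ • (n • P₀) = n • (τ • P₀) := fun n ↦
      map_nsmul (DistribSMul.toAddMonoidHom V.geomPoints τ) n P₀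
    obtain ⟨k, hk7, hk⟩ := hset _ hτP
    -- the images of `P, 2P, 3P` are `kP, 2kP, 3kP`
    have i1 : τ • P₀ = (k % 7) • P₀ := by rw [hk, ← hmod]
    have i2 : τ • ((2 : ℕ) • P₀) = (2 * k % 7) • P₀ := by rw [hτn, hk, ← mul_nsmul', hmod]
    have i3 : τ • ((3 : ℕ) • P₀) = (3 * k % 7) • P₀ := by rw [hτn, hk, ← mul_nsmul', hmod]
    rw [hQ₂] at i2
    rw [hQ₃] at i3
    have P1 : (1 : ℕ) • P₀ = (Affine.Point.some x₁ y₁ h₁ : Vb.toAffine.Point) := one_nsmul _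
    interval_cases k
    · exact (hPne (by simpa using congrArg (τ⁻¹ • ·) i1)).elim
    · -- k = 1 : identity
      simp only [Nat.reduceMod, Nat.reduceMul] at i1 i2 i3
      rw [P1] at i1; rw [hQ₂] at i2; rw [hQ₃] at i3
      have e1 := galois_x_eq_of_smul_eq i1
      have e2 := galois_x_eq_of_smul_eq i2
      have e3 := galois_x_eq_of_smul_eq i3
      exact ⟨by rw [map_add, map_add, e1, e2, e3], by
        rw [map_add, map_add, map_mul, map_mul, map_mul, e1, e2, e3], by
        rw [map_mul, map_mul, e1, e2, e3]⟩
    · -- k = 2 : (x₂, x₃, x₁)   [2P, 4P = -3P, 6P = -P]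
      simp only [Nat.reduceMod, Nat.reduceMul] at i1 i2 i3
      rw [hQ₂] at i1; rw [h4] at i2; rw [h6] at i3
      have e1 := galois_x_eq_of_smul_eq i1
      have e2 := galois_x_eq_of_smul_eq_neg i2
      have e3 := galois_x_eq_of_smul_eq_neg i3
      exact ⟨by rw [map_add, map_add, e1, e2, e3]; ring, by
        rw [map_add, map_add, map_mul, map_mul, map_mul, e1, e2, e3]; ring, by
        rw [map_mul, map_mul, e1, e2, e3]; ring⟩
    · -- k = 3 : (x₃, x₁, x₂)   [3P, 6P = -P, 9P = 2P]
      simp only [Nat.reduceMod, Nat.reduceMul] at i1 i2 i3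
      rw [hQ₃] at i1; rw [h6] at i2; rw [hQ₂] at i3
      have e1 := galois_x_eq_of_smul_eq i1
      have e2 := galois_x_eq_of_smul_eq_neg i2
      have e3 := galois_x_eq_of_smul_eq i3
      exact ⟨by rw [map_add, map_add, e1, e2, e3]; ring, by
        rw [map_add, map_add, map_mul, map_mul, map_mul, e1, e2, e3]; ring, by
        rw [map_mul, map_mul, e1, e2, e3]; ring⟩
    · -- k = 4 : (x₃, x₁, x₂)   [4P = -3P, 8P = P, 12P = 5P = -2P]
      simp only [Nat.reduceMod, Nat.reduceMul] at i1 i2 i3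
      rw [h4] at i1; rw [P1] at i2; rw [h5] at i3
      have e1 := galois_x_eq_of_smul_eq_neg i1
      have e2 := galois_x_eq_of_smul_eq i2
      have e3 := galois_x_eq_of_smul_eq_neg i3
      exact ⟨by rw [map_add, map_add, e1, e2, e3]; ring, by
        rw [map_add, map_add, map_mul, map_mul, map_mul, e1, e2, e3]; ring, by
        rw [map_mul, map_mul, e1, e2, e3]; ring⟩
    · -- k = 5 : (x₂, x₃, x₁)   [5P = -2P, 10P = 3P, 15P = P]
      simp only [Nat.reduceMod, Nat.reduceMul] at i1 i2 i3
      rw [h5] at i1; rw [hQ₃] at i2; rw [P1] at i3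
      have e1 := galois_x_eq_of_smul_eq_neg i1
      have e2 := galois_x_eq_of_smul_eq i2
      have e3 := galois_x_eq_of_smul_eq i3
      exact ⟨by rw [map_add, map_add, e1, e2, e3]; ring, by
        rw [map_add, map_add, map_mul, map_mul, map_mul, e1, e2, e3]; ring, by
        rw [map_mul, map_mul, e1, e2, e3]; ring⟩
    · -- k = 6 : (x₁, x₂, x₃)   [6P = -P, 12P = 5P = -2P, 18P = 4P = -3P]
      simp only [Nat.reduceMod, Nat.reduceMul] at i1 i2 i3
      rw [h6] at i1; rw [h5] at i2; rw [h4] at i3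
      have e1 := galois_x_eq_of_smul_eq_neg i1
      have e2 := galois_x_eq_of_smul_eq_neg i2
      have e3 := galois_x_eq_of_smul_eq_neg i3
      exact ⟨by rw [map_add, map_add, e1, e2, e3], by
        rw [map_add, map_add, map_mul, map_mul, map_mul, e1, e2, e3], by
        rw [map_mul, map_mul, e1, e2, e3]⟩
  -- descent and conclusion
  obtain ⟨s₀, hs₀⟩ := (InfiniteGalois.mem_range_algebraMap_iff_fixed (x₁ + x₂ + x₃)).mpr
    fun σ ↦ (hfix σ).1
  obtain ⟨p₀, hp₀⟩ :=
    (InfiniteGalois.mem_range_algebraMap_iff_fixed (x₁ * x₂ + x₁ * x₃ + x₂ * x₃)).mpr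
      fun σ ↦ (hfix σ).2.1
  obtain ⟨r₀, hr₀⟩ :=
    (InfiniteGalois.mem_range_algebraMap_iff_fixed (x₁ * x₂ * x₃)).mpr fun σ ↦ (hfix σ).2.2
  refine ⟨x₁, x₂, x₃, s₀, p₀, r₀, hs₀, hp₀, hr₀, hx₁₂, hf₁, hf₂, ?_, ?_, ?_⟩
  · rw [hba₄, hba₆] at hR1; linear_combination hR1
  · rw [hba₄, hba₆] at hR2; linear_combination hR2
  · rw [hba₄, hba₆] at hR3; linear_combination hR3


end Isogeny

/-! ### `j = 0`: no rational `7`-isogeny -/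

open Literature.NumberTheory.EllipticCurves

variable {K : Type u} [Field K] [CharZero K]

/-- In a field of characteristic `0` with no primitive cube root of unity, the binary form
`U² + 13UV + 49V²` (discriminant `-147 = -3·7²`) is anisotropic. [folklore] -/
theorem eq_zero_of_sq_add_13_mul_add_49_sq (h3 : ∀ u : K, u ^ 2 + u + 1 ≠ 0) {U W : K}
    (h : U ^ 2 + 13 * (U * W) + 49 * W ^ 2 = 0) : U = 0 ∧ W = 0 := by
  by_cases hW : W = 0
  · subst hW
    exact ⟨pow_eq_zero_iff two_ne_zero |>.mp (by linear_combination h), rfl⟩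
  · exfalso
    -- with `v = U/W`: `(2v + 13)² = 4(v² + 13v + 49) - 27 = -27`, so `w = (2v + 13)/3` has
    -- `w² = -3` and `u = (w - 1)/2` has `u² + u + 1 = 0`
    have hv : (U / W) ^ 2 + 13 * (U / W) + 49 = 0 := by
      field_simp
      linear_combination h
    refine h3 (((2 * (U / W) + 13) / 3 - 1) / 2) ?_
    linear_combination (1 / 9 : K) * hv

/-- In a field in which `21` is not a square, `U² + 5UV + V²` (discriminant `21`) is anisotropic.
[folklore] -/
theorem eq_zero_of_sq_add_5_mul_add_sq (h21 : ∀ u : K, u ^ 2 ≠ 21) {U W : K}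
    (h : U ^ 2 + 5 * (U * W) + W ^ 2 = 0) : U = 0 ∧ W = 0 := by
  by_cases hW : W = 0
  · subst hW
    exact ⟨pow_eq_zero_iff two_ne_zero |>.mp (by linear_combination h), rfl⟩
  · exfalso
    have hv : (U / W) ^ 2 + 5 * (U / W) + 1 = 0 := by
      field_simp
      linear_combination h
    exact h21 (2 * (U / W) + 5) (by linear_combination 4 * hv)

set_option maxHeartbeats 1600000 in
/-- **No rational `7`-isogeny at `j = 0` (short normal form).** A short Weierstrass elliptic curve
`y² = x³ + ax + b` over a field of characteristic `0` containing neither a primitive cube root of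
unity nor `√21` that admits a rational isogeny of degree `7` has `a ≠ 0` (i.e. `j ≠ 0`): with the
kernel coordinates of `exists_kernel_coords_of_degree_eq_seven₃`, both cleared Fricke identities of
`klein_seven_core` at `a = 0` force `U₁ = V₁ = U₂ = V₂ = 0`, hence `s₁ = s₂ = 0`, hence
`x₂ = ζx₁`, `x₃ = ζ²x₁` with `ζ² + ζ + 1 = 0`, `s₃ = x₁³`, and the duplication relation makes
`ζ = (s₃ − 8b)/(4(s₃ + b)) ∈ K`. [cite: SilvermanAEC2009, III.2.3, III.4.12] -/
theorem Isogeny.a₄_ne_zero_of_degree_eq_seven_of_isShortNF {V V' : WeierstrassCurve K}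
    [V.IsShortNF] [V.IsElliptic] (h3 : ∀ u : K, u ^ 2 + u + 1 ≠ 0) (h21 : ∀ u : K, u ^ 2 ≠ 21)
    (φ : Isogeny V V') (hdeg : φ.degree = 7) : V.a₄ ≠ 0 := by
  intro ha
  obtain ⟨x₁, x₂, x₃, s₀, p₀, r₀, hs, hp, hr, hx, hf₁, -, hR1, hR2, hR3⟩ :=
    φ.exists_kernel_coords_of_degree_eq_seven₃ hdeg
  set ι := algebraMap K (AlgebraicClosure K) with hι
  have hinj : Function.Injective ι := (algebraMap K (AlgebraicClosure K)).injective
  have hb : V.a₆ ≠ 0 := by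
    have hΔ : V.Δ ≠ 0 := by rw [← coe_Δ']; exact V.Δ'.ne_zero
    rw [V.Δ_of_isShortNF, ha] at hΔ
    intro h; apply hΔ; rw [h]; ring
  -- the two cleared identities at `a = 0`, pulled back to `K`
  obtain ⟨k1, k2⟩ := klein_seven_core hf₁ hx hR1 hR2 hR3 (ι s₀) (ι p₀) hs hp
  rw [ha, map_zero] at k1 k2
  have k1K : (27 * V.a₆ ^ 2) * (((18 * p₀ - 4 * s₀ ^ 2) ^ 2 +
      13 * ((18 * p₀ - 4 * s₀ ^ 2) * (s₀ ^ 2 - 3 * p₀)) + 49 * (s₀ ^ 2 - 3 * p₀) ^ 2) *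
      ((18 * p₀ - 4 * s₀ ^ 2) ^ 2 + 5 * ((18 * p₀ - 4 * s₀ ^ 2) * (s₀ ^ 2 - 3 * p₀)) +
        (s₀ ^ 2 - 3 * p₀) ^ 2) ^ 3) = 0 := by
    apply hinj
    simp only [map_mul, map_add, map_sub, map_pow, map_ofNat, map_zero]
    linear_combination -k1
  have k2K : (27 * V.a₆ ^ 2) * (((s₀ ^ 2 - 5 * p₀) ^ 2 + 13 * ((s₀ ^ 2 - 5 * p₀) * (2 * p₀)) +
      49 * (2 * p₀) ^ 2) * ((s₀ ^ 2 - 5 * p₀) ^ 2 + 5 * ((s₀ ^ 2 - 5 * p₀) * (2 * p₀)) +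
        (2 * p₀) ^ 2) ^ 3) = 0 := by
    apply hinj
    simp only [map_mul, map_add, map_sub, map_pow, map_ofNat, map_zero]
    linear_combination -k2
  have h27 : 27 * V.a₆ ^ 2 ≠ 0 := mul_ne_zero (by norm_num) (pow_ne_zero 2 hb)
  -- all four `U, V` vanish
  have hUV : ∀ {U W : K}, (27 * V.a₆ ^ 2) * ((U ^ 2 + 13 * (U * W) + 49 * W ^ 2) *
      (U ^ 2 + 5 * (U * W) + W ^ 2) ^ 3) = 0 → U = 0 ∧ W = 0 := by
    intro U W h
    rcases mul_eq_zero.mp ((mul_eq_zero.mp h).resolve_left h27) with h | h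
    · exact eq_zero_of_sq_add_13_mul_add_49_sq h3 h
    · exact eq_zero_of_sq_add_5_mul_add_sq h21 (pow_eq_zero_iff three_ne_zero |>.mp h)
  obtain ⟨-, hV₁⟩ := hUV k1K
  obtain ⟨-, hV₂⟩ := hUV k2K
  have hp0 : p₀ = 0 := by linear_combination hV₂ / 2
  have hs0 : s₀ = 0 := pow_eq_zero_iff two_ne_zero |>.mp (by rw [hp0] at hV₁; linear_combination hV₁)
  rw [hs0, map_zero] at hs
  rw [hp0, map_zero] at hp
  -- `x₃ = -x₁ - x₂`, `x₁² + x₁x₂ + x₂² = 0`, `x₁ ≠ 0`, `ζ = x₂/x₁`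
  have hx₃ : x₃ = -x₁ - x₂ := by linear_combination -hs
  have hq : x₁ ^ 2 + x₁ * x₂ + x₂ ^ 2 = 0 := by rw [hx₃] at hp; linear_combination hp
  have hx₁ : x₁ ≠ 0 := by
    intro h0
    rw [h0] at hq hx
    have : x₂ = 0 := pow_eq_zero_iff two_ne_zero |>.mp (by linear_combination hq)
    exact hx this.symm
  obtain ⟨ζ, hζ⟩ : ∃ ζ : AlgebraicClosure K, ζ = x₂ / x₁ := ⟨_, rfl⟩
  have hx₂ : x₂ = ζ * x₁ := by rw [hζ, div_mul_cancel₀ _ hx₁]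
  have hζ2 : ζ ^ 2 + ζ + 1 = 0 := by
    have := hq
    rw [hx₂] at this
    have h' : x₁ ^ 2 * (ζ ^ 2 + ζ + 1) = 0 := by linear_combination this
    exact (mul_eq_zero.mp h').resolve_left (pow_ne_zero 2 hx₁)
  -- `s₃ = x₁³`
  have hr' : ι r₀ = x₁ ^ 3 := by
    rw [hr, hx₃, hx₂]
    linear_combination (-(x₁ ^ 3)) * hζ2
  -- the duplication relation at `a = 0`: `4(x₁³ + b) ζ = x₁³ - 8b`
  rw [ha, map_zero] at hR1 hf₁
  simp only [zero_mul, mul_zero, add_zero, sub_zero, zero_pow two_ne_zero] at hR1 hf₁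
  have hdup : 4 * (x₁ ^ 3 + ι V.a₆) * ζ = x₁ ^ 3 - 8 * ι V.a₆ := by
    have h' : x₁ * (4 * (x₁ ^ 3 + ι V.a₆) * ζ - (x₁ ^ 3 - 8 * ι V.a₆)) = 0 := by
      rw [hx₂] at hR1; linear_combination hR1
    linear_combination (mul_eq_zero.mp h').resolve_left hx₁
  have hden : x₁ ^ 3 + ι V.a₆ ≠ 0 := hf₁
  -- `ζ` is rational
  have hζK : ζ = ι ((r₀ - 8 * V.a₆) / (4 * (r₀ + V.a₆))) := by
    have hdenK : 4 * (r₀ + V.a₆) ≠ 0 := by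
      intro h0
      apply hden
      have : ι (4 * (r₀ + V.a₆)) = 0 := by rw [h0, map_zero]
      rw [map_mul, map_add, map_ofNat, hr'] at this
      linear_combination this / 4
    rw [map_div₀, map_sub, map_mul, map_mul, map_add, map_ofNat, map_ofNat, hr',
      eq_div_iff (by rw [← hr', ← map_add, ← map_ofNat ι 4, ← map_mul]; exact
        (map_ne_zero_iff ι hinj).mpr hdenK)]
    linear_combination hdup
  refine h3 ((r₀ - 8 * V.a₆) / (4 * (r₀ + V.a₆))) (hinj ?_)
  rw [map_add, map_add, map_pow, map_one, map_zero, ← hζK]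
  exact hζ2

/-- **No rational `7`-isogeny at `j = 0`.** An elliptic curve over a field `K` of characteristic
`0` containing neither a primitive cube root of unity (`u² + u + 1 ≠ 0`) nor `√21` which admits a
`K`-rational isogeny of degree `7` has `j ≠ 0`. Over `ℚ` (`j_ne_zero_of_degree_eq_seven_rat`) this
is the statement that the fibre of `X₀(7)` over `j = 0` — the `CM` `7`-isogenies of `y² = x³ + b`
over `ℚ(√-3)` (`t² + 13t + 49 = 0`) and the two ramified points over `ℚ(√21)` (`t² + 5t + 1 = 0`)
— has no rational point; it removes the hypothesis `j ≠ 0` of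
`Isogeny.exists_j_eq_klein_seven_of_degree_eq_seven` over such fields.
[cite: SilvermanAEC2009, III.1.4(b), III.2.3, III.4.12] -/
theorem Isogeny.j_ne_zero_of_degree_eq_seven {W W' : WeierstrassCurve K} [W.IsElliptic]
    (h3 : ∀ u : K, u ^ 2 + u + 1 ≠ 0) (h21 : ∀ u : K, u ^ 2 ≠ 21) (φ : Isogeny W W')
    (hdeg : φ.degree = 7) : W.j ≠ 0 := by
  haveI : Invertible (2 : K) := invertibleOfNonzero two_ne_zero
  haveI : Invertible (3 : K) := invertibleOfNonzero three_ne_zero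
  obtain ⟨C, hC⟩ := W.exists_variableChange_isShortNF
  obtain ⟨ψ, hψ⟩ := φ.exists_degree_eq_of_variableChange C
  have ha := ψ.a₄_ne_zero_of_degree_eq_seven_of_isShortNF h3 h21 (hψ.trans hdeg)
  intro hj
  apply ha
  rw [← variableChange_j W C, (C • W).j_of_isShortNF] at hj
  have hΔ : (C • W).Δ ≠ 0 := by rw [← coe_Δ']; exact (C • W).Δ'.ne_zero
  rw [(C • W).Δ_of_isShortNF] at hΔ
  rcases div_eq_zero_iff.mp hj with h | h
  · exact pow_eq_zero_iff three_ne_zero |>.mp (by linear_combination h / 6912)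
  · exact absurd (by linear_combination -16 * h) hΔ

/-- `ℚ` contains no primitive cube root of unity: `u² + u + 1 = (u + 1/2)² + 3/4 > 0`. [folklore] -/
theorem rat_sq_add_self_add_one_ne_zero (u : ℚ) : u ^ 2 + u + 1 ≠ 0 := by
  nlinarith [sq_nonneg (u + 1 / 2)]

/-- **Over `ℚ`, an elliptic curve with a rational `7`-isogeny has `j ≠ 0`** (the fibre of `X₀(7)`
over `j = 0` has no rational point; `21` is not a rational square since it is not the square of a
natural number, `Rat.isSquare_natCast_iff`). [cite: SilvermanAEC2009, III.1.4(b), III.4.12] -/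
theorem Isogeny.j_ne_zero_of_degree_eq_seven_rat {W W' : WeierstrassCurve ℚ} [W.IsElliptic]
    (φ : Isogeny W W') (hdeg : φ.degree = 7) : W.j ≠ 0 := by
  refine φ.j_ne_zero_of_degree_eq_seven rat_sq_add_self_add_one_ne_zero (fun u h ↦ ?_) hdeg
  have hsq : IsSquare ((21 : ℕ) : ℚ) := ⟨u, by push_cast; rw [← h]; ring⟩
  rw [Rat.isSquare_natCast_iff] at hsq
  obtain ⟨r, hr⟩ := hsq
  have hr5 : r ≤ 5 := by nlinarith
  interval_cases r <;> omega

end WeierstrassCurve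

end
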